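import Summits.QuantumFields.BalabanUV.Beta.WilsonJetReflection2Trace
import Summits.QuantumFields.BalabanUV.Beta.WilsonReflectionContact

/-!
# `BalabanUV.Beta.WilsonStencilReflection2` — binder row D1, W-side leaf (W-0W), stage S3b: **THE `(2,2)` AXIS-REFLECTION LAW OF THE
# SYMMETRISED TRACED TWO-BOND TABLE `wsym22 N` ON `ℤ^{d+1}`, WITH CONTACT** (β sub-cell, row BETA-an3, lineage an3 gen 32)

HONEST FRAMING (cell charter, verbatim): «discharging BetaPertH makes Balaban's UV stability UNCONDITIONAL — a real
constructive-QFT result; it is NOT the continuum limit and NOT the Clay problem.»  Neutral finite algebra ([folklore]): the finite-lattice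
law `WilsonJetReflection2Trace.jet22_pull_traced_wsym22` (S3a) instantiated on the discrete torus `(ZMod M)^{d+1}` with gen-29's reflection
`WilsonReflectionContact.srefM` (whose `srefM_involutive ∕ srefM_frame₁ ∕ srefM_frame₂` discharge the three reflection hypotheses) and
pulled back to `ℤ^{d+1}` along `WilsonStencilTransport.castVec M`, injective on the finite window of sites that occur — exactly the
pattern of gen-29's `WilsonReflectionContact.S₀A_bref` (first order) and leaf-09's `WilsonBiStencilWardZ.wEntry₂_wsym22_div_Z` (Ward side);
no statement of Bałaban's papers, no `[cite:]`; instantiates no binder of the wall.  NOT D1, NOT `BetaPertH`, NOT continuum, NOT Clay.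

THE STATEMENT (`bondPairTab_wsym22_bref`).  For every axis `α`, bonds `(u₁,κ₁)`, `(u₂,κ₂)` and legs `(x,a)`, `(z,b)` of `ℤ^{d+1}`
(frame `B6BondElimination.unitVec`, an2's `ResolventReflection.bref`, `PolarizationSign.reflSign`), with `X := bref α a x`,
`Z := bref α b z`:

  `BPT(bref α κ₁ u₁, κ₁; bref α κ₂ u₂, κ₂; wsym22 N)((x,a),(z,b))`
  `  = ε_κ₁ ε_κ₂ ε_a ε_b · ( BPT(u₁,κ₁; u₂,κ₂; wsym22 N)((X,a),(Z,b))`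
  `      − 4N²·(([X=u₂∧a=α∧α=κ₂] − [Z=u₂∧b=α∧α=κ₂])·S₀A(u₁,κ₁)((X,a),(Z,b)) + ([X=u₁∧a=α∧α=κ₁] − [Z=u₁∧b=α∧α=κ₁])·S₀A(u₂,κ₂)((X,a),(Z,b)))`
  `      + 4N²·([Z=u₁∧b=α∧u₁=u₂∧α=κ₁∧α=κ₂]·Lc α u₁ (X,a) + [X=u₁∧a=α∧u₁=u₂∧α=κ₁∧α=κ₂]·Lc α u₁ (Z,b))`
  `      − 4N²·([(X,a)=(u₁,α)∧(Z,b)=(u₂,α)∧α=κ₁∧α=κ₂] + [(Z,b)=(u₁,α)∧(X,a)=(u₂,α)∧α=κ₁∧α=κ₂])·Lc α u₂ (u₁,α) )`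

— REFLECTED TABLE = signs · (TABLE AT REFLECTED LEGS + FIELD-SUPPORTED LOCAL CONTACT), the curl–curl numbers of the finite law written
window-free through gen-29's contact functional `Lc` (`WilsonStencilDivergence.curlCurl_eq_two_mul_Lc`).  §1 the window and the transfer;
§2 the law.  Consumer: S3c (`wilsonW₂ d (wsym22 N)` in the shape of the owner's socket `hQ` of `SecondOrderZeroLaw.quarticZero_bref_of_laws`).
Provenance: β sub-cell, unit beta-an3 gen 32, 2026-08-20 (v1); no existing file touched.
-/

namespace Summit.QuantumFields.BalabanUV.Beta.WilsonStencilReflection2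

open Finset
open scoped BigOperators
open Literature.MathematicalPhysics.QuantumFieldTheory.Balaban1983to89
open Literature.MathematicalPhysics.QuantumFieldTheory.Balaban1983to89.Beta
open ColourTrace (Complete TrOrthonormal)
open PlaquetteStencilData (WilsonIdx wα wβ)
open PlaquetteVertex2Stencil (off)
open WilsonVertex2Kron (bondPairTab)
open WilsonVertex2Sym (wsym22)
open ResolventReflection (bref bref_bref)
open PolarizationSign (reflSign)
open B6BondElimination (unitVec)
open Summit.QuantumFields.BalabanUV.Beta.WilsonReflectionFrame (sgn rsite Lc S₀A sgn_mul_self)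
open Summit.QuantumFields.BalabanUV.Beta.WilsonStencilDivergence (curlCurl curlCurl_eq_two_mul_Lc)
open Summit.QuantumFields.BalabanUV.Beta.WilsonStencilTransport (castVec castVec_injOn S₀A_map Lc_map)
open Summit.QuantumFields.BalabanUV.Beta.WilsonReflectionContact (srefM srefM_involutive srefM_frame₁ srefM_frame₂ castVec_bref
  sgn_eq_reflSign)
open Summit.QuantumFields.BalabanUV.Beta.WilsonBiStencilWardZ (bondPairTab_map)
open Summit.QuantumFields.BalabanUV.Beta.WilsonJetReflection2Trace (jet22_pull_traced_wsym22)

variable {d : ℕ}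

/-! ## §1 The finite window of sites and the transfer torus -/

section Window

/-- index type of the finite window of the transfer.  A definition asserting nothing. [folklore] -/
abbrev RIdx₂ (d : ℕ) : Type :=
  Fin 8 ⊕ ((Bool × Fin (d + 1) × Fin (d + 1) × Fin 4 × Fin 4) ⊕ ((Bool × Bool × WilsonIdx (Fin (d + 1)))
    ⊕ (Bool × ((Fin (d + 1) × Fin (d + 1)) ⊕ (Bool × Fin (d + 1))))))

/-- the bond base point selected by a Boolean.  A definition asserting nothing. [folklore] -/
def bsel (u₁ u₂ : Fin (d + 1) → ℤ) : Bool → (Fin (d + 1) → ℤ)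
  | true => u₁
  | false => u₂

/-- THE FINITE WINDOW OF SITES of the transfer for the bonds `(u₁,κ₁)`, `(u₂,κ₂)`, the axis `α` and the legs `(x,a)`, `(z,b)`: the legs and
their reflections `X = bref α a x`, `Z = bref α b z`, the two base points and their images `bref α κⱼ uⱼ`, the plaquette points
`bref α κ₁ u₁ − off k + off l` and `u₁ − off k + off l` of the two-bond tables, the first-order supports `uⱼ + wα κⱼ i`, `uⱼ + wβ κⱼ i`, and
the sites `uⱼ − e_ν + e_μ`, `uⱼ − e_ν`, `uⱼ + e_μ` read by the contact functional.  A definition asserting nothing. [folklore] -/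
def rpts₂ (α κ₁ κ₂ a b : Fin (d + 1)) (u₁ u₂ x z : Fin (d + 1) → ℤ) : RIdx₂ d → (Fin (d + 1) → ℤ)
  | Sum.inl 0 => x
  | Sum.inl 1 => z
  | Sum.inl 2 => bref α a x
  | Sum.inl 3 => bref α b z
  | Sum.inl 4 => u₁
  | Sum.inl 5 => u₂
  | Sum.inl 6 => bref α κ₁ u₁
  | Sum.inl 7 => bref α κ₂ u₂
  | Sum.inr (Sum.inl (true, μ, ν, k, l)) => bref α κ₁ u₁ - off unitVec μ ν k + off unitVec μ ν l
  | Sum.inr (Sum.inl (false, μ, ν, k, l)) => u₁ - off unitVec μ ν k + off unitVec μ ν l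
  | Sum.inr (Sum.inr (Sum.inl (true, true, i))) => u₁ + wα unitVec κ₁ i
  | Sum.inr (Sum.inr (Sum.inl (true, false, i))) => u₁ + wβ unitVec κ₁ i
  | Sum.inr (Sum.inr (Sum.inl (false, true, i))) => u₂ + wα unitVec κ₂ i
  | Sum.inr (Sum.inr (Sum.inl (false, false, i))) => u₂ + wβ unitVec κ₂ i
  | Sum.inr (Sum.inr (Sum.inr (j, Sum.inl (ν, μ)))) => bsel u₁ u₂ j - unitVec ν + unitVec μ
  | Sum.inr (Sum.inr (Sum.inr (j, Sum.inr (true, ν)))) => bsel u₁ u₂ j - unitVec ν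
  | Sum.inr (Sum.inr (Sum.inr (j, Sum.inr (false, μ)))) => bsel u₁ u₂ j + unitVec μ

/-- THE MODULUS of the transfer torus (one is added when used).  A definition asserting nothing. [folklore] -/
def rmod₂ (α κ₁ κ₂ a b : Fin (d + 1)) (u₁ u₂ x z : Fin (d + 1) → ℤ) : ℕ :=
  ∑ i, ∑ i', ∑ j, (rpts₂ α κ₁ κ₂ a b u₁ u₂ x z i j - rpts₂ α κ₁ κ₂ a b u₁ u₂ x z i' j).natAbs

end Window

/-! ## §2 The law on `ℤ^{d+1}` -/

section Law

open scoped Matrix.Norms.Operator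

/-- [folklore] **THE `(2,2)` AXIS-REFLECTION LAW WITH CONTACT OF THE SYMMETRISED TRACED TWO-BOND TABLE ON `ℤ^{d+1}`** (see the module
docstring; `X := bref α a x`, `Z := bref α b z`): the torus instance of `WilsonJetReflection2Trace.jet22_pull_traced_wsym22` (reflection
`srefM (rmod₂+1) α`, frame `castVec ∘ unitVec`) pulled back along `castVec (rmod₂+1)`; the hypotheses `Complete τ`, `TrOrthonormal τ`,
`N ≠ 0` and the background colour `c` are those of the trace identities (the conclusion does not mention `τ`). -/
theorem bondPairTab_wsym22_bref {N : ℕ} {C : Type*} [Fintype C] [DecidableEq C] {τ : C → Matrix (Fin N) (Fin N) ℂ} (hτ : Complete τ)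
    (ho : TrOrthonormal τ) (hN : N ≠ 0) (c : C) (α κ₁ κ₂ a b : Fin (d + 1)) (u₁ u₂ x z : Fin (d + 1) → ℤ) :
    bondPairTab unitVec (bref α κ₁ u₁) κ₁ (bref α κ₂ u₂) κ₂ (wsym22 N) (x, a) (z, b) =
      reflSign α κ₁ * reflSign α κ₂ * (reflSign α a * reflSign α b) *
        (bondPairTab unitVec u₁ κ₁ u₂ κ₂ (wsym22 N) (bref α a x, a) (bref α b z, b)
          - 4 * (N : ℝ) ^ 2 * ((if bref α a x = u₂ ∧ a = α ∧ α = κ₂ then S₀A unitVec u₁ κ₁ (bref α a x, a) (bref α b z, b) else 0)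
              - (if bref α b z = u₂ ∧ b = α ∧ α = κ₂ then S₀A unitVec u₁ κ₁ (bref α a x, a) (bref α b z, b) else 0)
              + (if bref α a x = u₁ ∧ a = α ∧ α = κ₁ then S₀A unitVec u₂ κ₂ (bref α a x, a) (bref α b z, b) else 0)
              - (if bref α b z = u₁ ∧ b = α ∧ α = κ₁ then S₀A unitVec u₂ κ₂ (bref α a x, a) (bref α b z, b) else 0))
          + 4 * (N : ℝ) ^ 2 * ((if bref α b z = u₁ ∧ b = α ∧ u₁ = u₂ ∧ α = κ₁ ∧ α = κ₂ then Lc unitVec α u₁ (bref α a x, a) else 0)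
              + (if bref α a x = u₁ ∧ a = α ∧ u₁ = u₂ ∧ α = κ₁ ∧ α = κ₂ then Lc unitVec α u₁ (bref α b z, b) else 0))
          - 4 * (N : ℝ) ^ 2 * ((if (bref α a x = u₁ ∧ a = α) ∧ (bref α b z = u₂ ∧ b = α) ∧ α = κ₁ ∧ α = κ₂ then
                Lc unitVec α u₂ (u₁, α) else 0)
              + (if (bref α b z = u₁ ∧ b = α) ∧ (bref α a x = u₂ ∧ a = α) ∧ α = κ₁ ∧ α = κ₂ then Lc unitVec α u₂ (u₁, α) else 0))) := by
  set M : ℕ := rmod₂ α κ₁ κ₂ a b u₁ u₂ x z + 1 with hM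
  have hS : Set.InjOn (castVec M) (Set.range (rpts₂ α κ₁ κ₂ a b u₁ u₂ x z)) := castVec_injOn (rpts₂ α κ₁ κ₂ a b u₁ u₂ x z)
  -- the torus law, at the legs `castVec X`, `castVec Z` (whose reflections are `castVec x`, `castVec z`)
  have key := jet22_pull_traced_wsym22 (Λ := Fin (d + 1) → ZMod M) (e := ⇑(castVec M) ∘ unitVec) hτ ho hN c (srefM_involutive M α)
    (fun y κ hκ => srefM_frame₁ M hκ y) (srefM_frame₂ M α) (castVec M u₁) (castVec M u₂) κ₁ κ₂ (castVec M (bref α a x)) a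
    (castVec M (bref α b z)) b
  have r₁ : rsite (srefM M α) (⇑(castVec M) ∘ unitVec) α κ₁ (castVec M u₁) = castVec M (bref α κ₁ u₁) := (castVec_bref M α κ₁ u₁).symm
  have r₂ : rsite (srefM M α) (⇑(castVec M) ∘ unitVec) α κ₂ (castVec M u₂) = castVec M (bref α κ₂ u₂) := (castVec_bref M α κ₂ u₂).symm
  have r₃ : rsite (srefM M α) (⇑(castVec M) ∘ unitVec) α a (castVec M (bref α a x)) = castVec M x := by rw [← castVec_bref, bref_bref]
  have r₄ : rsite (srefM M α) (⇑(castVec M) ∘ unitVec) α b (castVec M (bref α b z)) = castVec M z := by rw [← castVec_bref, bref_bref]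
  rw [r₁, r₂, r₃, r₄] at key
  -- memberships in the window
  have mx : x ∈ Set.range (rpts₂ α κ₁ κ₂ a b u₁ u₂ x z) := ⟨Sum.inl 0, rfl⟩
  have mz : z ∈ Set.range (rpts₂ α κ₁ κ₂ a b u₁ u₂ x z) := ⟨Sum.inl 1, rfl⟩
  have mX : bref α a x ∈ Set.range (rpts₂ α κ₁ κ₂ a b u₁ u₂ x z) := ⟨Sum.inl 2, rfl⟩
  have mZ : bref α b z ∈ Set.range (rpts₂ α κ₁ κ₂ a b u₁ u₂ x z) := ⟨Sum.inl 3, rfl⟩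
  have mu₁ : u₁ ∈ Set.range (rpts₂ α κ₁ κ₂ a b u₁ u₂ x z) := ⟨Sum.inl 4, rfl⟩
  have mu₂ : u₂ ∈ Set.range (rpts₂ α κ₁ κ₂ a b u₁ u₂ x z) := ⟨Sum.inl 5, rfl⟩
  have mU₂ : bref α κ₂ u₂ ∈ Set.range (rpts₂ α κ₁ κ₂ a b u₁ u₂ x z) := ⟨Sum.inl 7, rfl⟩
  have mP₁ : ∀ (μ ν : Fin (d + 1)) (k l : Fin 4),
      bref α κ₁ u₁ - off unitVec μ ν k + off unitVec μ ν l ∈ Set.range (rpts₂ α κ₁ κ₂ a b u₁ u₂ x z) :=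
    fun μ ν k l => ⟨Sum.inr (Sum.inl (true, μ, ν, k, l)), rfl⟩
  have mP₂ : ∀ (μ ν : Fin (d + 1)) (k l : Fin 4), u₁ - off unitVec μ ν k + off unitVec μ ν l ∈ Set.range (rpts₂ α κ₁ κ₂ a b u₁ u₂ x z) :=
    fun μ ν k l => ⟨Sum.inr (Sum.inl (false, μ, ν, k, l)), rfl⟩
  have mα₁ : ∀ i, u₁ + wα unitVec κ₁ i ∈ Set.range (rpts₂ α κ₁ κ₂ a b u₁ u₂ x z) := fun i => ⟨Sum.inr (Sum.inr (Sum.inl (true, true, i))), rfl⟩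
  have mβ₁ : ∀ i, u₁ + wβ unitVec κ₁ i ∈ Set.range (rpts₂ α κ₁ κ₂ a b u₁ u₂ x z) := fun i => ⟨Sum.inr (Sum.inr (Sum.inl (true, false, i))), rfl⟩
  have mα₂ : ∀ i, u₂ + wα unitVec κ₂ i ∈ Set.range (rpts₂ α κ₁ κ₂ a b u₁ u₂ x z) := fun i => ⟨Sum.inr (Sum.inr (Sum.inl (false, true, i))), rfl⟩
  have mβ₂ : ∀ i, u₂ + wβ unitVec κ₂ i ∈ Set.range (rpts₂ α κ₁ κ₂ a b u₁ u₂ x z) :=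
    fun i => ⟨Sum.inr (Sum.inr (Sum.inl (false, false, i))), rfl⟩
  have m₃ : ∀ j ν μ, bsel u₁ u₂ j - unitVec ν + unitVec μ ∈ Set.range (rpts₂ α κ₁ κ₂ a b u₁ u₂ x z) :=
    fun j ν μ => ⟨Sum.inr (Sum.inr (Sum.inr (j, Sum.inl (ν, μ)))), rfl⟩
  have m₁ : ∀ j ν, bsel u₁ u₂ j - unitVec ν ∈ Set.range (rpts₂ α κ₁ κ₂ a b u₁ u₂ x z) :=
    fun j ν => ⟨Sum.inr (Sum.inr (Sum.inr (j, Sum.inr (true, ν)))), rfl⟩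
  have m₂ : ∀ j μ, bsel u₁ u₂ j + unitVec μ ∈ Set.range (rpts₂ α κ₁ κ₂ a b u₁ u₂ x z) :=
    fun j μ => ⟨Sum.inr (Sum.inr (Sum.inr (j, Sum.inr (false, μ)))), rfl⟩
  -- transport of every table and functional
  have t₁ : bondPairTab (⇑(castVec M) ∘ unitVec) (castVec M (bref α κ₁ u₁)) κ₁ (castVec M (bref α κ₂ u₂)) κ₂ (wsym22 N) (castVec M x, a)
      (castVec M z, b) = bondPairTab unitVec (bref α κ₁ u₁) κ₁ (bref α κ₂ u₂) κ₂ (wsym22 N) (x, a) (z, b) :=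
    bondPairTab_map _ hS unitVec _ κ₁ _ κ₂ _ mx mz mU₂ mP₁ a b
  have t₂ : bondPairTab (⇑(castVec M) ∘ unitVec) (castVec M u₁) κ₁ (castVec M u₂) κ₂ (wsym22 N) (castVec M (bref α a x), a)
      (castVec M (bref α b z), b) = bondPairTab unitVec u₁ κ₁ u₂ κ₂ (wsym22 N) (bref α a x, a) (bref α b z, b) :=
    bondPairTab_map _ hS unitVec u₁ κ₁ u₂ κ₂ _ mX mZ mu₂ mP₂ a b
  have t₃ : S₀A (⇑(castVec M) ∘ unitVec) (castVec M u₁) κ₁ (castVec M (bref α a x), a) (castVec M (bref α b z), b) =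
      S₀A unitVec u₁ κ₁ (bref α a x, a) (bref α b z, b) := S₀A_map _ hS unitVec u₁ κ₁ mX mZ mα₁ mβ₁ a b
  have t₄ : S₀A (⇑(castVec M) ∘ unitVec) (castVec M u₂) κ₂ (castVec M (bref α a x), a) (castVec M (bref α b z), b) =
      S₀A unitVec u₂ κ₂ (bref α a x, a) (bref α b z, b) := S₀A_map _ hS unitVec u₂ κ₂ mX mZ mα₂ mβ₂ a b
  have t₅ : Lc (⇑(castVec M) ∘ unitVec) α (castVec M u₁) (castVec M (bref α a x), a) = Lc unitVec α u₁ (bref α a x, a) :=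
    Lc_map _ hS unitVec α u₁ _ a mX mu₁ (m₁ true) (m₂ true) (m₃ true)
  have t₆ : Lc (⇑(castVec M) ∘ unitVec) α (castVec M u₁) (castVec M (bref α b z), b) = Lc unitVec α u₁ (bref α b z, b) :=
    Lc_map _ hS unitVec α u₁ _ b mZ mu₁ (m₁ true) (m₂ true) (m₃ true)
  have t₇ : Lc (⇑(castVec M) ∘ unitVec) α (castVec M u₂) (castVec M u₁, α) = Lc unitVec α u₂ (u₁, α) :=
    Lc_map _ hS unitVec α u₂ u₁ α mu₁ mu₂ (m₁ false) (m₂ false) (m₃ false)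
  -- the curl–curl numbers through the contact functional, the factor `2` taken out of the cut-offs
  have two_out : ∀ (p : Prop) [Decidable p] (v : ℝ), (if p then 2 * v else 0) = 2 * (if p then v else 0) := by
    intro p _ v; split_ifs <;> ring
  simp only [curlCurl_eq_two_mul_Lc, t₁, t₂, t₃, t₄, t₅, t₆, t₇, hS.eq_iff mX mu₁, hS.eq_iff mX mu₂, hS.eq_iff mZ mu₁, hS.eq_iff mZ mu₂,
    hS.eq_iff mu₁ mu₂, sgn_eq_reflSign, two_out] at key
  -- solve for the reflected table (`ε² = 1`)
  have hs : reflSign α κ₁ * reflSign α κ₂ * (reflSign α a * reflSign α b) * (reflSign α κ₁ * reflSign α κ₂ * (reflSign α a * reflSign α b))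
      = 1 := by
    have e₁ := sgn_mul_self α κ₁; have e₂ := sgn_mul_self α κ₂; have e₃ := sgn_mul_self α a; have e₄ := sgn_mul_self α b
    simp only [sgn_eq_reflSign] at e₁ e₂ e₃ e₄
    linear_combination (reflSign α κ₂ * reflSign α κ₂ * (reflSign α a * reflSign α a) * (reflSign α b * reflSign α b)) * e₁
      + (reflSign α a * reflSign α a * (reflSign α b * reflSign α b)) * e₂ + (reflSign α b * reflSign α b) * e₃ + e₄
  linear_combination (reflSign α κ₁ * reflSign α κ₂ * (reflSign α a * reflSign α b)) * key
    - bondPairTab unitVec (bref α κ₁ u₁) κ₁ (bref α κ₂ u₂) κ₂ (wsym22 N) (x, a) (z, b) * hs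

end Law

end Summit.QuantumFields.BalabanUV.Beta.WilsonStencilReflection2
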